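import Literature.IUT.LogThetaLattice.PacketLogVolumesPrincipalPackets
import Literature.IUT.LogVolume.AdelicPacketModel
import Literature.IUT.LogVolume.ArchimedeanVolume
import HarnessLib

/-!
# [IUTchIII] Proposition 3.9 (iii) at the GENUINE adelic Haar model: packets `⊕_{v | v_ℚ} F_v` of
# completions with their Haar / radial volumes, and the invariance of the global log-volume under
# `F^×` from `μ_v(f·T) = ‖f‖_v·μ_v(T)` and the product formula (abc-iut cell, layer L6 ↔ campaign S)

S. Mochizuki, *Inter-universal Teichmüller theory III*, kurims manuscript (May 2020), §3, Proposition
3.9, pp. 115–118 [claim: Mochizuki2012, status: disputed]. Printed text, (i) p. 115: "the `p_{v_ℚ}`-adic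
log-volume on each of the direct summand `p_{v_ℚ}`-adic fields of `𝓘^ℚ(^α𝓕_{v_ℚ})` … together with the
discussion of normalized weights in Remark 3.1.1, (ii), (iii), (iv) — determines [cf. [AbsTopIII],
Proposition 5.7, (i)] log-volumes `μ^log_{α,v_ℚ} : 𝕄(𝓘^ℚ(^α𝓕_{v_ℚ})) → ℝ`"; p. 116 (archimedean `v_ℚ`):
"the sum of the radial log-volumes on each of the direct summand complex archimedean fields …
determines [cf. [AbsTopIII], Proposition 5.7, (ii)] log-volumes … Here, we assume that these
log-volumes are normalized so that multiplication of an element of "`𝕄(−)`" by `e = 2.71828...`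
corresponds to adding the quantity `1 = log(e) ∈ ℝ`"; (iii) p. 117: "by adding the log-volumes of (i)
[all but finitely many of which are zero!] at the various `v_ℚ ∈ 𝕍_ℚ`, one obtains a global log-volume
`μ^log_{A,𝕍_ℚ} : 𝕄(𝓘^ℚ(^A𝓕_{𝕍_ℚ})) → ℝ` which is invariant with respect to multiplication by elements of
`(†𝕄⊛_mod)_α = (†𝕄⊛_MOD)_α ⊆ 𝓘^ℚ(^A𝓕_{𝕍_ℚ})` … the global log-volume `μ^log_{A,𝕍_ℚ}(𝔍)` is equal to the
degree of the arithmetic line bundle determined by `𝔍` … relative to a suitable normalization."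
Remark 3.1.1 (ii), p. 94: "the normalized weight
`1/([K_v : (F_mod)_v]·(Σ_{𝕍_mod ∋ w | v_ℚ} [(F_mod)_w : ℚ_{v_ℚ}]))`".

WHAT THIS FILE ADDS. The statement file `PacketLogVolumes.lean` (abc-iut-L6-t4) types (iii) as the
predicates `Prop39iii_invariance μlog act` / `Prop39iii_degree μlog regionOf deg` over ABSTRACT packet
log-volumes `μlog : ∀ v_ℚ, Region v_ℚ → ℝ`; the instances landed so far (abc-iut-L6-d3:
`PacketLogVolumesPrincipalBridge`, `…PrincipalPackets`, `…Capsules(Normalized)`) are SHADOW models whose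
regions are divisor coordinates and whose "log-volumes" are degrees by definition (SUBDAG
`plan/L6/SUBDAG-IUTchIII-Prop-39.md`, residual row R-iii). Here the packet at `v_ℚ` is the GENUINE one of
the printed text in the case `|A| = 1`, `K = F_mod = F`:
* at a finite place `v | p`, the completion `F_v` (Mathlib's `v.adicCompletion F`) with the volume `μ_v`
  of [AbsTopIII] Prop. 5.7 (i) — the Haar measure with `μ_v(𝒪_v) = 1` (campaign-S
  `Literature.IUT.LogVolume.localVolume`), acted on by `f ∈ F^×` through `F ↪ F_v`;
* at an archimedean place `w`, the complex archimedean field `ℂ` with the RADIAL volume of [AbsTopIII]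
  Prop. 5.7 (ii) (`Literature.IUT.LogVolume.radialVolume`, `μ(𝒪_ℂ) = 1`, `μ(x·A) = |x|·μ(A)`), acted on
  through the embedding `σ_w : F ↪ ℂ` (`w.embedding`);
* regions at `v_ℚ` = families `(T_v)_{v | v_ℚ}` of subsets of positive finite volume (print's "`𝕄(−)`":
  nonempty compact opens, resp. compact closures of nonempty opens, all qualify), i.e. the direct-product
  region `∏_{v | v_ℚ} T_v ⊆ ⊕_{v|v_ℚ} F_v = F ⊗_ℚ ℚ_{v_ℚ}` (the 1-packet, [IUTchIII] Prop. 3.1 (i));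
* packet log-volume `μ^log_{v_ℚ}(T) = Σ_{v | v_ℚ} c_v · log μ_v(T_v)` with the weights `c_v = 1/[F:ℚ]` at
  finite `v` — Remark 3.1.1 (ii)'s normalized weight for `K = F_mod` (`Σ_{w|p}[F_w:ℚ_p] = [F:ℚ]`,
  `sum_localDegree`) — and `c_w = [F_w:ℝ]/[F:ℚ]` at archimedean `w` — Remark 3.1.1 (ii)'s weight
  `1/[F:ℚ]` (`Σ_{w|∞}[F_w:ℝ] = [F:ℚ]`) multiplied by the PACKET-NORMALISATION factor `[F_w:ℝ]` that
  Prop. 3.9 (i) imposes at archimedean `v_ℚ` ("normalized so that multiplication … by `e` corresponds to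
  adding … `log(e)`": radial log-volumes move by `log|x|` under `x`, [AbsTopIII] Prop. 5.7 (ii)(b), so the
  weights of the complex summands must sum to `1`; for the totally complex fields of [IUTchI] Def. 3.1 (b)
  this factor is uniformly `[ℂ:ℝ] = 2`).

RESULTS (sorry-free, axioms standard; no file of t4/t5/S2/c312-d1 is edited):
* `PlaceHaarDatum` packages, per place, carrier / volume / `F`-action / modulus, with the one law
  `μ(f·T) = ‖f‖·μ(T)`; `archDatum w` (ℂ, radial volume, `‖f‖_w = |σ_w(f)|`) and `nonarchDatum v` (`F_v`,
  Haar volume, `‖f‖_v` = Mathlib's `adicAbv`) are THEOREMS of measure theory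
  (`radialVolume_smul`; `localVolume_units_smul` + `CompletionModel.distribHaarChar_eq_norm`);
* `haarPacketLogVolume F v_ℚ` = the datum `μ^log_{v_ℚ}` of Prop. 3.9 (iii) on GENUINE regions, and
  `haarPrincipalAction F f` = multiplication by `f ∈ F^×` (it preserves "zero log-volume for all but
  finitely many `v_ℚ`": `‖f‖_v = 1` for almost all `v`);
* **`prop39iii_invariance_haarModel : Prop39iii_invariance (haarPacketLogVolume F) (haarPrincipalAction F)`**
  — the printed invariance clause HOLDS at the genuine model: the packet at `v_ℚ` moves by
  `Σ_{v|v_ℚ} c_v·log‖f‖_v` and these move by `(1/[F:ℚ])·(Σ_{w|∞}[F_w:ℝ]·log|f|_w + Σ_{v∤∞} log‖f‖_v) = 0`,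
  the product formula (`sum_mult_log_add_sum_log_adicAbv_eq_zero`, log of Mathlib's
  `NumberField.prod_abs_eq_one`), fed into abc-iut-L6-t5's `Prop39iii_invariance_of_productFormula`;
* NOT in this file — the DEGREE clause lives in the companion `PacketLogVolumesHaarModelDegree.lean`
  (abc-iut-L6-d3; `prop39iii_degree_haarModel`: `Prop39iii_degree` HOLDS at this model with the normalisation
  constant `c = 1/[F:ℚ]` for the objects `𝔍 = {J_v}` = genuine fractional ideals `J_v = 𝔭_v^{-n_v}𝒪_v =
  {‖x‖_v ≤ q_v^{n_v}}` at the finite places and dilated unit discs `J_w = e^{t_w}·𝒪_ℂ` at the archimedean ones,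
  `μ^log_{𝕍_ℚ}(𝔍) = deg_F(𝔍)/[F:ℚ]`), and the two packet-normalisation clauses of Prop. 3.9 (i) ("`×p_v ↦ −log p_v`",
  "`×e ↦ +log e`") as theorems of Haar measure live in `PacketLogVolumesHaarModelNormalization.lean`.

HONEST SCOPE. (1) `K = F_mod = F`: for a general `K ⊋ F_mod` the summand is `K_v`, `mod_{K_v}(f) =
‖f‖_{(F_mod)_v}^{[K_v:(F_mod)_v]}` for `f ∈ F_mod`, and the exponent cancels the factor `[K_v:(F_mod)_v]^{-1}` of
the printed weight — the same computation, not typed here. (2) `|A| = 1`; the `n`-tensor packet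
`⊗_α F_{v_α} ≅ ⊕_i K_i` ([IUTchIII] Prop. 3.1 (i)) reduces to this file summand-wise (campaign-S
`TensorPacketHaar`), not typed here. (3) The archimedean summand is `ℂ` at EVERY archimedean place (faithful
for complex places — all of them for the totally complex `F ∋ √−1` of [IUTchI] Def. 3.1 (b); at a real place
of a general `F` the model still embeds `F_w = ℝ ⊂ ℂ` and uses the radial volume of `ℂ`). (4) Regions are ALL
positive-finite-volume families (a superset of print's `𝕄(−)`); the identities hold on all of them.
Nothing here constructs `(†𝓕⊛_mod)_α` or a Frobenioid, asserts anything about [IUTchIII] Cor. 3.12, or takes a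
side; typed ≠ endorsed. The mathematics proved is classical (Haar measure + the product formula).
-/

noncomputable section

namespace Literature.IUT.LogThetaLattice

open Literature.IUT.LogVolume NumberField IsDedekindDomain MeasureTheory Metric Set
open scoped ENNReal NNReal Pointwise

/-! ### Per-place Haar data: carrier, volume, action of `F`, modulus -/

/-- The local datum of [IUTchIII] Prop. 3.9 (i) at ONE place `v` of `F`, packaged: the summand `F_v` of the
1-packet ("direct summand `p_{v_ℚ}`-adic field" resp. "direct summand complex archimedean field"), its volume
`μ_v` on subsets ([AbsTopIII] Prop. 5.7 (i) resp. the radial volume of (ii)), the action of `f ∈ F` by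
multiplication through `F ↪ F_v`, and the modulus `‖f‖_v`, subject to the ONE law
`μ_v(f·T) = ‖f‖_v·μ_v(T)` ([AbsTopIII] Prop. 5.7 (i)(b)/(ii)(b) "`μ^log_k(x·A) = μ^log_k(A) + μ̇^log_k(x)`").
A Σ-type packaging of genuine data (see `archDatum`, `nonarchDatum`), not an interface with unproved axioms.
[claim: Mochizuki2012, status: disputed] -/
structure PlaceHaarDatum (F : Type) [Field F] : Type 1 where
  /-- the summand `F_v` -/
  X : Type
  /-- the volume `μ_v` on subsets of `F_v` -/
  vol : Set X → ℝ≥0∞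
  /-- multiplication of a subset by (the image in `F_v` of) `f ∈ F` -/
  act : F → Set X → Set X
  /-- the modulus `‖f‖_v = μ_v(f·𝒪_v)/μ_v(𝒪_v)` -/
  modulus : F → ℝ
  /-- `‖f‖_v > 0` for `f ≠ 0` -/
  modulus_pos : ∀ {f : F}, f ≠ 0 → 0 < modulus f
  /-- [AbsTopIII] Prop. 5.7 (i)(b)/(ii)(b): `μ_v(f·T) = ‖f‖_v · μ_v(T)` -/
  vol_act : ∀ {f : F}, f ≠ 0 → ∀ T : Set X, vol (act f T) = ENNReal.ofReal (modulus f) * vol T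

namespace PlaceHaarDatum

variable {F : Type} [Field F] (D : PlaceHaarDatum F)

/-- The admissible regions at one place: subsets of POSITIVE FINITE volume (print's "`𝕄(−)`" = nonempty
compact open subsets resp. compact closures of nonempty open subsets all qualify; [IUTchIII] Prop. 3.9 (i)
p. 115/116). [claim: Mochizuki2012, status: disputed] -/
def Adm : Type := {T : Set D.X // 0 < D.vol T ∧ D.vol T < ∞}

/-- The log-volume `μ^log_v(T) := log μ_v(T)` ([AbsTopIII] Prop. 5.7 "`μ^log_k(−) := log(μ_k(−))`").
[claim: Mochizuki2012, status: disputed] -/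
def logVol (T : Set D.X) : ℝ := Real.log (D.vol T).toReal

/-- Multiplication by `f ∈ F^×` preserves admissibility (`μ_v(f·T) = ‖f‖_v·μ_v(T)`, `‖f‖_v > 0`).
[claim: Mochizuki2012, status: disputed] -/
def actAdm (f : Fˣ) (T : D.Adm) : D.Adm :=
  ⟨D.act (f : F) T.1, by
    have hm := D.modulus_pos f.ne_zero
    rw [D.vol_act f.ne_zero]
    exact ⟨ENNReal.mul_pos (by simpa using hm) T.2.1.ne', ENNReal.mul_lt_top ENNReal.ofReal_lt_top T.2.2⟩⟩

/-- Underlying set of `f·T`. [claim: Mochizuki2012, status: disputed] -/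
@[simp] theorem actAdm_val (f : Fˣ) (T : D.Adm) : (D.actAdm f T).1 = D.act (f : F) T.1 := rfl

/-- **[AbsTopIII] Prop. 5.7 (i)(b)/(ii)(b) in log form**: `μ^log_v(f·T) = μ^log_v(T) + log‖f‖_v` on admissible
`T`. [claim: Mochizuki2012, status: disputed] -/
theorem logVol_actAdm (f : Fˣ) (T : D.Adm) :
    D.logVol (D.actAdm f T).1 = D.logVol T.1 + Real.log (D.modulus (f : F)) := by
  have hm := D.modulus_pos f.ne_zero
  have hT : (D.vol T.1).toReal ≠ 0 := (ENNReal.toReal_pos T.2.1.ne' T.2.2.ne).ne'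
  rw [logVol, actAdm_val, D.vol_act f.ne_zero, ENNReal.toReal_mul, ENNReal.toReal_ofReal hm.le,
    Real.log_mul hm.ne' hT, logVol, add_comm]

end PlaceHaarDatum

variable (F : Type) [Field F] [NumberField F]

/-! ### The two genuine data: `ℂ` with the radial volume, `F_v` with the Haar volume -/

/-- **The archimedean summand** at `w ∈ 𝕍(F)^arc`: the complex archimedean field `ℂ` with the RADIAL volume of
[AbsTopIII] Prop. 5.7 (ii) (`μ(𝒪_ℂ) = 1`, `μ(x·A) = |x|·μ(A)` — campaign-S `radialVolume_smul`), `f ∈ F` acting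
through `σ_w = w.embedding : F →+* ℂ`, modulus `‖f‖_w = |σ_w(f)| = w f` (Mathlib
`InfinitePlace.norm_embedding_eq`). ([IUTchIII] Prop. 3.9 (i) p. 116 "radial log-volumes on each of the
direct summand complex archimedean fields".) [claim: Mochizuki2012, status: disputed] -/
def archDatum (w : InfinitePlace F) : PlaceHaarDatum F where
  X := ℂ
  vol := radialVolume
  act f T := (w.embedding f) • T
  modulus f := w f
  modulus_pos hf := InfinitePlace.pos_iff.mpr hf
  vol_act {f} _ T := by
    show radialVolume ((w.embedding f) • T) = _
    rw [radialVolume_smul, InfinitePlace.norm_embedding_eq]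

/-- **The nonarchimedean summand** at `v ∈ 𝕍(F)^non`: the completion `F_v` (Mathlib `v.adicCompletion F`, a
proper ultrametric local field by the tree's `properSpace_adicCompletion`) with the volume of [AbsTopIII]
Prop. 5.7 (i) (Haar, `μ_v(𝒪_v) = 1`: campaign-S `localVolume`), `f ∈ F` acting through Mathlib's
`FinitePlace.embedding v : F →+* F_v`, modulus `‖f‖_v = q_v^{-ord_v(f)}` (Mathlib `adicAbv`). The law
`μ_v(f·T) = ‖f‖_v·μ_v(T)` is `localVolume_units_smul` (`μ(x·A) = mod(x)·μ(A)`) with abc-iut-c312-d1's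
`CompletionModel.distribHaarChar_eq_norm` (`mod_{F_v} = ‖·‖`) and `FinitePlace.norm_embedding`.
([IUTchIII] Prop. 3.9 (i) p. 115 "the `p_{v_ℚ}`-adic log-volume on each of the direct summand `p_{v_ℚ}`-adic
fields".) [claim: Mochizuki2012, status: disputed] -/
def nonarchDatum (v : HeightOneSpectrum (𝓞 F)) : PlaceHaarDatum F :=
  letI := Literature.NumberTheory.GaloisRepresentations.Ultrametric.AdicCompletion.nontriviallyNormedField F v
  letI : ProperSpace (v.adicCompletion F) := Literature.NumberTheory.Automorphic.properSpace_adicCompletion F v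
  letI : MeasurableSpace (v.adicCompletion F) := CompletionModel.measurableSpace F v
  haveI : BorelSpace (v.adicCompletion F) := ⟨rfl⟩
  { X := v.adicCompletion F
    vol := fun T => localVolume (v.adicCompletion F) T
    act := fun f T => (FinitePlace.embedding v f) • T
    modulus := fun f => NumberField.HeightOneSpectrum.adicAbv F v f
    modulus_pos := fun hf => (NumberField.HeightOneSpectrum.adicAbv F v).pos hf
    vol_act := fun {f} hf T => by
      have hf' : FinitePlace.embedding v f ≠ 0 := by
        intro h
        exact hf ((map_eq_zero (FinitePlace.embedding v)).mp h)
      have hsmul : (FinitePlace.embedding v f) • T = (Units.mk0 _ hf') • T := rfl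
      have hmod := CompletionModel.distribHaarChar_eq_norm F v (Units.mk0 _ hf')
      rw [Units.val_mk0, FinitePlace.norm_embedding] at hmod
      rw [hsmul, localVolume_units_smul, ← hmod, ENNReal.ofReal_coe_nnreal] }

omit [NumberField F] in
/-- The modulus of the archimedean datum is `|f|_w`. [claim: Mochizuki2012, status: disputed] -/
@[simp] theorem archDatum_modulus (w : InfinitePlace F) (f : F) : (archDatum F w).modulus f = w f := rfl

/-- The modulus of the nonarchimedean datum is `‖f‖_v`. [claim: Mochizuki2012, status: disputed] -/
@[simp] theorem nonarchDatum_modulus (v : HeightOneSpectrum (𝓞 F)) (f : F) :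
    (nonarchDatum F v).modulus f = NumberField.HeightOneSpectrum.adicAbv F v f := rfl

/-- The local datum at a place `v ∈ 𝕍(F) = 𝕍(F)^arc ⊔ 𝕍(F)^non`. [claim: Mochizuki2012, status: disputed] -/
def placeDatum : Place F → PlaceHaarDatum F := Sum.elim (archDatum F) (nonarchDatum F)

/-- `placeDatum (inl w) = archDatum w`. [claim: Mochizuki2012, status: disputed] -/
@[simp] theorem placeDatum_inl (w : InfinitePlace F) : placeDatum F (Sum.inl w) = archDatum F w := rfl

/-- `placeDatum (inr v) = nonarchDatum v`. [claim: Mochizuki2012, status: disputed] -/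
@[simp] theorem placeDatum_inr (v : HeightOneSpectrum (𝓞 F)) : placeDatum F (Sum.inr v) = nonarchDatum F v :=
  rfl

/-! ### The weights of Remark 3.1.1 (ii) (case `K = F_mod`), packet-normalised -/

/-- The weight of the summand at `v` in the packet log-volume: `1/[F:ℚ]` at a finite place (Remark 3.1.1 (ii)
p. 94: `1/([K_v:(F_mod)_v]·Σ_{w|v_ℚ}[(F_mod)_w:ℚ_{v_ℚ}])` with `K = F_mod`, `Σ_{w|p}[F_w:ℚ_p] = [F:ℚ]`), and
`[F_w:ℝ]/[F:ℚ]` at an archimedean place (the same weight `1/Σ_{w|∞}[F_w:ℝ] = 1/[F:ℚ]` times the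
packet-normalisation factor `[F_w:ℝ]` of Prop. 3.9 (i) p. 116, see the module docstring).
[claim: Mochizuki2012, status: disputed] -/
def haarWeight : Place F → ℝ :=
  Sum.elim (fun w => (w.mult : ℝ) / Module.finrank ℚ F) (fun _ => 1 / Module.finrank ℚ F)

/-- `haarWeight (inl w) = [F_w:ℝ]/[F:ℚ]`. [claim: Mochizuki2012, status: disputed] -/
@[simp] theorem haarWeight_inl (w : InfinitePlace F) :
    haarWeight F (Sum.inl w) = (w.mult : ℝ) / Module.finrank ℚ F := rfl

/-- `haarWeight (inr v) = 1/[F:ℚ]`. [claim: Mochizuki2012, status: disputed] -/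
@[simp] theorem haarWeight_inr (v : HeightOneSpectrum (𝓞 F)) :
    haarWeight F (Sum.inr v) = 1 / Module.finrank ℚ F := rfl

/-- All weights are positive. [claim: Mochizuki2012, status: disputed] -/
theorem haarWeight_pos (v : Place F) : 0 < haarWeight F v := by
  rcases v with w | v
  · exact div_pos (by exact_mod_cast InfinitePlace.mult_pos) (FinDivisor.finrank_pos (F := F))
  · exact div_pos one_pos (FinDivisor.finrank_pos (F := F))

/-- **Packet-normalisation at `∞`** ([IUTchIII] Prop. 3.9 (i) p. 116): the archimedean weights sum to `1`
(`Σ_w [F_w:ℝ] = [F:ℚ]`, Mathlib `InfinitePlace.sum_mult_eq`), so that multiplying every complex summand by `e`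
— which adds `log|e| = 1` to each radial log-volume — adds exactly `1 = log(e)` to the packet log-volume.
[claim: Mochizuki2012, status: disputed] -/
theorem sum_haarWeight_arch : ∑ w : InfinitePlace F, haarWeight F (Sum.inl w) = 1 := by
  simp only [haarWeight_inl, div_eq_mul_inv, ← Finset.sum_mul]
  rw [← Nat.cast_sum, InfinitePlace.sum_mult_eq]
  exact mul_inv_cancel₀ (FinDivisor.finrank_pos (F := F)).ne'

/-! ### The packet log-volume `μ^log_{v_ℚ}` on genuine regions and the action of `F^×` -/

/-- **[IUTchIII] Prop. 3.9 (i)/(iii) datum `μ^log_{v_ℚ}` at the genuine model**: the region at `v_ℚ` is a family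
`T = (T_v)_{v | v_ℚ}` of admissible subsets `T_v ⊆ F_v` (the direct-product region `∏_{v|v_ℚ} T_v` of the
1-packet `⊕_{v | v_ℚ} F_v`), and `μ^log_{v_ℚ}(T) := Σ_{v | v_ℚ} c_v · log μ_v(T_v)` — "the [`p_{v_ℚ}`-adic / radial]
log-volume on each of the direct summand … fields … together with the … normalized weights".
[claim: Mochizuki2012, status: disputed] -/
def haarPacketLogVolume (q : RatPlace) (T : ∀ v : Packet F q, (placeDatum F v.1).Adm) : ℝ :=
  ∑ v : Packet F q, haarWeight F v.1 * (placeDatum F v.1).logVol (T v).1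

/-- The LOCAL change of `μ^log_{v_ℚ}` under `f ∈ F^×`: `Σ_{v | v_ℚ} c_v · log‖f‖_v` (the packet regrouping of the
terms of the product formula). [claim: Mochizuki2012, status: disputed] -/
def packetLogModulus (f : Fˣ) (q : RatPlace) : ℝ :=
  ∑ v : Packet F q, haarWeight F v.1 * Real.log ((placeDatum F v.1).modulus (f : F))

/-- `μ^log_{v_ℚ}(f·T) = μ^log_{v_ℚ}(T) + Σ_{v|v_ℚ} c_v·log‖f‖_v`. [claim: Mochizuki2012, status: disputed] -/
theorem haarPacketLogVolume_actAdm (f : Fˣ) (q : RatPlace) (T : ∀ v : Packet F q, (placeDatum F v.1).Adm) :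
    haarPacketLogVolume F q (fun v => (placeDatum F v.1).actAdm f (T v)) =
      haarPacketLogVolume F q T + packetLogModulus F f q := by
  simp only [haarPacketLogVolume, packetLogModulus, PlaceHaarDatum.logVol_actAdm, mul_add,
    Finset.sum_add_distrib]

/-- `‖f‖_v ≠ 1` only at finitely many places: the terms `c_v·log‖f‖_v` are finitely supported on `𝕍(F)`
(archimedean places are finitely many; `ord_v(f) ≠ 0` for finitely many finite `v`).
[claim: Mochizuki2012, status: disputed] -/
theorem finite_support_logModulus (f : Fˣ) :
    (Function.support fun v : Place F => haarWeight F v * Real.log ((placeDatum F v).modulus (f : F))).Finite := by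
  refine ((Set.finite_range (Sum.inl : InfinitePlace F → Place F)).union
    ((finite_setOf_ord_ne_zero F (f : F)).image Sum.inr)).subset ?_
  rintro (w | v) hv
  · exact Or.inl ⟨w, rfl⟩
  · refine Or.inr ⟨v, ?_, rfl⟩
    rw [Function.mem_support, placeDatum_inr, nonarchDatum_modulus] at hv
    have h1 : Real.log (NumberField.HeightOneSpectrum.adicAbv F v (f : F)) ≠ 0 := right_ne_zero_of_mul hv
    have h2 : NumberField.HeightOneSpectrum.adicAbv F v (f : F) ≠ 1 := fun h => h1 (by rw [h, Real.log_one])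
    exact (ord_ne_zero_iff_adicAbv_ne_one F v f.ne_zero).mpr h2

/-- Hence the packet changes `v_ℚ ↦ Σ_{v|v_ℚ} c_v·log‖f‖_v` are finitely supported on `𝕍_ℚ`.
[claim: Mochizuki2012, status: disputed] -/
theorem finite_support_packetLogModulus (f : Fˣ) : (Function.support (packetLogModulus F f)).Finite :=
  finite_support_packet_sum F _ (finite_support_logModulus F f)

/-- **The product formula, weighted and summed over `𝕍(F)`**:
`Σ_v c_v·log‖f‖_v = (1/[F:ℚ])·(Σ_{w|∞} [F_w:ℝ]·log|f|_w + Σ_{v∤∞} log‖f‖_v) = 0`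
(`sum_mult_log_add_sum_log_adicAbv_eq_zero`, the logarithm of Mathlib's `NumberField.prod_abs_eq_one`).
[claim: Mochizuki2012, status: disputed] -/
theorem finsum_logModulus_eq_zero (f : Fˣ) :
    ∑ᶠ v : Place F, haarWeight F v * Real.log ((placeDatum F v).modulus (f : F)) = 0 := by
  classical
  set T : Finset (HeightOneSpectrum (𝓞 F)) := (finite_setOf_ord_ne_zero F (f : F)).toFinset with hTdef
  have hT : {v | ord F v (f : F) ≠ 0} ⊆ (T : Set _) := by
    intro v hv
    simpa [hTdef] using hv
  have hsupp : (Function.support fun v : Place F =>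
      haarWeight F v * Real.log ((placeDatum F v).modulus (f : F))) ⊆
      ((Finset.univ.disjSum T : Finset (Place F)) : Set (Place F)) := by
    rintro (w | v) hv
    · simp [Finset.mem_disjSum]
    · rw [Finset.mem_coe, Finset.inr_mem_disjSum]
      rw [Function.mem_support, placeDatum_inr, nonarchDatum_modulus] at hv
      have h1 : Real.log (NumberField.HeightOneSpectrum.adicAbv F v (f : F)) ≠ 0 := right_ne_zero_of_mul hv
      have h2 : NumberField.HeightOneSpectrum.adicAbv F v (f : F) ≠ 1 :=
        fun h => h1 (by rw [h, Real.log_one])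
      exact hT ((ord_ne_zero_iff_adicAbv_ne_one F v f.ne_zero).mpr h2)
  rw [finsum_eq_sum_of_support_subset _ hsupp, Finset.sum_disjSum]
  simp only [placeDatum_inl, placeDatum_inr, archDatum_modulus, nonarchDatum_modulus, haarWeight_inl,
    haarWeight_inr]
  have key := sum_mult_log_add_sum_log_adicAbv_eq_zero f.ne_zero hT
  have hd : (Module.finrank ℚ F : ℝ) ≠ 0 := (FinDivisor.finrank_pos (F := F)).ne'
  calc ∑ w : InfinitePlace F, (w.mult : ℝ) / Module.finrank ℚ F * Real.log (w (f : F)) +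
        ∑ v ∈ T, 1 / Module.finrank ℚ F * Real.log (NumberField.HeightOneSpectrum.adicAbv F v (f : F))
      = (Module.finrank ℚ F : ℝ)⁻¹ * (∑ w : InfinitePlace F, (w.mult : ℝ) * Real.log (w (f : F)) +
          ∑ v ∈ T, Real.log (NumberField.HeightOneSpectrum.adicAbv F v (f : F))) := by
        rw [mul_add, Finset.mul_sum, Finset.mul_sum]
        congr 1 <;> refine Finset.sum_congr rfl fun x _ => ?_ <;> ring
    _ = 0 := by rw [key, mul_zero]

/-- **The product formula regrouped by rational places**: `Σ_{v_ℚ ∈ 𝕍_ℚ} Σ_{v | v_ℚ} c_v·log‖f‖_v = 0`.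
[claim: Mochizuki2012, status: disputed] -/
theorem finsum_packetLogModulus_eq_zero (f : Fˣ) : ∑ᶠ q, packetLogModulus F f q = 0 := by
  change ∑ᶠ q, ∑ v : Packet F q,
    (fun v : Place F => haarWeight F v * Real.log ((placeDatum F v).modulus (f : F))) v.1 = 0
  rw [finsum_packet_regroup F _ (finite_support_logModulus F f), finsum_logModulus_eq_zero]

/-- **[IUTchIII] Prop. 3.9 (iii) "multiplication by elements of `(†𝕄⊛_mod)_α`" at the genuine model**: `f ∈ F^×`
acts on a global region `(T_v)_v` by `T_v ↦ f·T_v` (through `F ↪ F_v` at every place); the result is again a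
global region — "zero log-volume for all but finitely many `v_ℚ`" is preserved because `‖f‖_v = 1` for almost
all `v`. [claim: Mochizuki2012, status: disputed] -/
def haarPrincipalAction (f : Fˣ) (S : GlobalRegion (haarPacketLogVolume F)) :
    GlobalRegion (haarPacketLogVolume F) :=
  ⟨fun q v => (placeDatum F v.1).actAdm f (S.1 q v), by
    refine (S.2.union (finite_support_packetLogModulus F f)).subset fun q hq => ?_
    by_contra hq'
    rw [Set.mem_union, not_or, Function.notMem_support, Function.notMem_support] at hq'
    apply Function.mem_support.mp hq
    change haarPacketLogVolume F q (fun v => (placeDatum F v.1).actAdm f (S.1 q v)) = 0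
    rw [haarPacketLogVolume_actAdm, hq'.1, hq'.2, add_zero]⟩

/-- Components of `f·S`. [claim: Mochizuki2012, status: disputed] -/
@[simp] theorem haarPrincipalAction_apply (f : Fˣ) (S : GlobalRegion (haarPacketLogVolume F)) (q : RatPlace)
    (v : Packet F q) : (haarPrincipalAction F f S).1 q v = (placeDatum F v.1).actAdm f (S.1 q v) := rfl

/-- **IUTchIII:Prop3.9(iii)** (kurims p. 117) INVARIANCE CLAUSE AT THE GENUINE HAAR MODEL:
`Prop39iii_invariance (haarPacketLogVolume F) (haarPrincipalAction F)` HOLDS — "a global log-volume … which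
is invariant with respect to multiplication by elements of `(†𝕄⊛_mod)_α`", for the printed packets
`⊕_{v|v_ℚ} F_v` with their Haar / radial volumes and normalized weights: abc-iut-L6-t5's
`Prop39iii_invariance_of_productFormula` fed with the local law `μ^log_{v_ℚ}(f·T) = μ^log_{v_ℚ}(T) +
Σ_{v|v_ℚ} c_v·log‖f‖_v` ([AbsTopIII] Prop. 5.7 (i)(b), (ii)(b)) and the product formula
(`finsum_packetLogModulus_eq_zero`). [claim: Mochizuki2012, status: disputed] -/
theorem prop39iii_invariance_haarModel :
    Prop39iii_invariance (haarPacketLogVolume F) (haarPrincipalAction F) :=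
  Prop39iii_invariance_of_productFormula (haarPacketLogVolume F) (haarPrincipalAction F)
    (packetLogModulus F) (finite_support_packetLogModulus F) (finsum_packetLogModulus_eq_zero F)
    (fun f S q => haarPacketLogVolume_actAdm F f q (S.1 q))

/-- The invariance unfolded: `μ^log_{𝕍_ℚ}(f·S) = μ^log_{𝕍_ℚ}(S)` for every `f ∈ F^×` and every global region
`S`. [claim: Mochizuki2012, status: disputed] -/
theorem globalLogVolume_haarPrincipalAction (f : Fˣ) (S : GlobalRegion (haarPacketLogVolume F)) :
    globalLogVolume (haarPacketLogVolume F) (haarPrincipalAction F f S) =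
      globalLogVolume (haarPacketLogVolume F) S :=
  prop39iii_invariance_haarModel F f S

end Literature.IUT.LogThetaLattice

end
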